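import Literature.NumberTheory.EllipticCurves.PAdicBSDSplitMultiplicativeProofs
import Literature.NumberTheory.EllipticCurves.PAdicLFunctionMultiplicativeInterpolation
import Literature.NumberTheory.EllipticCurves.RootNumberTwistProofs
import Literature.NumberTheory.EllipticCurves.Rank1Residual.X11RankOneCertificates.Claim
import HarnessLib

/-!
# Existence of `L_p(E, T)` at a prime of NON-split multiplicative reduction (Mazur–Tate–Teitelbaum 1986, §I.10–I.14, `α = a_p = −1`)

Theorems only. Discharge of the named fact
`Literature.NumberTheory.EllipticCurves.Rank1Residual.X11RankOneCertificates.exists_isMultPAdicLFunctionOf_neg_one`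
(file `Rank1Residual/X11RankOneCertificates/Claim.lean`, cell `b2b-bsdres` unit `b2b-bsdres-x11c`):
if `E/ℚ` has non-split multiplicative reduction at `p` and `f` is its newform then some
`L ∈ ℚ_p⟦T⟧` satisfies `IsMultPAdicLFunctionOf f p (-1) L` (bounded = in `Λ ⊗ ℚ_p`; constant term
`(1 − α⁻¹)[0]⁺ = 2[0]⁺`; interpolation `L(χ(γ) − 1) = α^{-m} ∑_a χ(a)[a/p^m]⁺`). The proof is the
twin of the tree's split existence theorem `exists_isSplitMultPAdicLFunctionOf`
(`PAdicBSDSplitMultiplicativeProofs`): at a non-split multiplicative place `a_p(f) = a_p(E) = −1`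
(the local factor is `1/(1 + T)`, `LFunction_apply_primesEquiv_of_hasNonsplitMultiplicativeReductionAt`,
transported from `ℚ_[p]` to the place over `p` by the tree bridges
`hasMultiplicativeReductionAtPrime_iff_hasMultiplicativeReductionAt_ringOfIntegers` and
`hasSplitMultiplicativeReductionAtPrime_iff_hasSplitMultiplicativeReductionAt`), hence `p ∣ N`
(`IsNewformOf.primesEquiv_dvd_level_of_not_hasGoodReductionAt`) and the `U_p`-relation gives
`∑_{b ≡ a mod pⁿ} [b/pⁿ⁺¹]⁺ = −[a/pⁿ]⁺` (`sum_fiber_ratPlusSymbol_eq_neg`); so the SIGNED distribution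
`μₙ(a) = (−1)ⁿ [a/pⁿ]⁺` (MTT §I.10: `μ_{f,α}(a + pⁿℤ_p) = α^{-n}[a/pⁿ]⁺`) is a bounded measure
(Manin–Drinfeld bound `exists_norm_ratPlusSymbol_le`), its Mellin transform exists
(`exists_powerSeries_of_bounded_distribution`), its total mass is
`∑_{u ∈ (ℤ/p)ˣ} μ₁(u) = −(∑_{a mod p}[a/p]⁺ − [0]⁺) = −(−[0]⁺ − [0]⁺) = 2[0]⁺`, and the twisted
moments are `(−1)^m ∑_a χ(a)[a/p^m]⁺ = α^{-m} ∑_a χ(a)[a/p^m]⁺`.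

References: B. Mazur, J. Tate, J. Teitelbaum, Invent. Math. 84 (1986) §I.10 Prop., §I.11, §I.14
(14.3) [MazurTateTeitelbaum1986Invent]; R. Greenberg, LNM 1716 §4 (the factor `(1 − α⁻¹)`)
[GreenbergLNM1716]; J. H. Silverman, *AEC* §C.16 [SilvermanAEC2009].
-/

noncomputable section

open scoped MatrixGroups ModularForm

open CongruenceSubgroup IsDedekindDomain Literature.NumberTheory.EllipticCurves.ModularForms

namespace WeierstrassCurve

section LFunction

open Rat.HeightOneSpectrum NumberField

/-- At a finite place `v` of `𝓞 ℚ` of NON-split multiplicative reduction the inverted local factor of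
Mathlib's `WeierstrassCurve.LFunction` is `1/(1 + T)`, so `a_p(W) = −1` for `p = primesEquiv v`
(Silverman, *AEC*, §C.16, `L_v(T) = 1 + T`). Twin of
`LFunction_apply_primesEquiv_and_sq_of_hasSplitMultiplicativeReductionAt`.
(Dot-notation extension of the Mathlib namespace `WeierstrassCurve`.)
[cite: SilvermanAEC2009, §C.16 (definition of L_v(T)), PDF p. 390] -/
theorem LFunction_apply_primesEquiv_of_hasNonsplitMultiplicativeReductionAt
    (W : WeierstrassCurve ℚ) {v : HeightOneSpectrum (𝓞 ℚ)}
    (hm : W.HasMultiplicativeReductionAt v) (hns : ¬ W.HasSplitMultiplicativeReductionAt v) :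
    W.LFunction (primesEquiv v) = -1 := by
  have hm' : ((W.baseChange (v.adicCompletion ℚ)).minimal
      (v.adicCompletionIntegers ℚ)).HasMultiplicativeReduction (v.adicCompletionIntegers ℚ) := hm
  have hns' : ¬ ((W.baseChange (v.adicCompletion ℚ)).minimal
      (v.adicCompletionIntegers ℚ)).HasSplitMultiplicativeReduction (v.adicCompletionIntegers ℚ) := hns
  have hg : ¬ ((W.baseChange (v.adicCompletion ℚ)).minimal
      (v.adicCompletionIntegers ℚ)).HasGoodReduction (v.adicCompletionIntegers ℚ) :=
    hm'.not_hasGoodReduction _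
  have h1 : PowerSeries.coeff 1 ((W.baseChange (v.adicCompletion ℚ)).localPowerSeries
      (v.adicCompletionIntegers ℚ)) = -1 := by
    rw [localPowerSeries, PowerSeries.coeff_one_invOfUnit_one, localPolynomial, if_neg hg,
      if_neg hns', if_pos hm']
    simp
  have h := W.LFunction_apply_prime_pow v 1
  rwa [pow_one, h1] at h

end LFunction

end WeierstrassCurve

namespace Literature.NumberTheory.EllipticCurves.ModularForms

section Newform

open Rat.HeightOneSpectrum NumberField

variable {N : ℕ} [NeZero N] {f : CuspForm (Gamma0 N) 2} {p : ℕ} [Fact p.Prime]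
  {W : WeierstrassCurve ℚ}

/-- **`a_p(f) = −1` and `p ∣ N` at a prime of non-split multiplicative reduction** for the newform `f`
of `E = W / ℚ`: transport non-split multiplicative reduction from `ℚ_[p]` to the place of `𝓞 ℚ` over
`p` (tree bridges for multiplicative and for split multiplicative reduction), read `a_p(W) = −1` off the
local factor, and get `p ∣ N` from bad reduction
(`IsNewformOf.primesEquiv_dvd_level_of_not_hasGoodReductionAt`).
[cite: SilvermanAEC2009, §C.16 (definition of L_v(T)), PDF p. 390] -/
theorem IsNewformOf.cuspCoeff_eq_neg_one_and_dvd_of_nonsplit (hf : IsNewformOf W f)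
    (hmult : W.HasMultiplicativeReductionAtPrime p)
    (hns : ¬ W.HasSplitMultiplicativeReductionAtPrime p) :
    cuspCoeff f p = -1 ∧ p ∣ N := by
  haveI := hf.isElliptic
  obtain ⟨v, hv⟩ : ∃ v : HeightOneSpectrum (𝓞 ℚ), (primesEquiv v : ℕ) = p :=
    ⟨primesEquiv.symm ⟨p, Fact.out⟩, by rw [Equiv.apply_symm_apply]⟩
  subst hv
  have hm : W.HasMultiplicativeReductionAt v :=
    (W.hasMultiplicativeReductionAtPrime_iff_hasMultiplicativeReductionAt_ringOfIntegers v).mp hmult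
  have hnsv : ¬ W.HasSplitMultiplicativeReductionAt v := fun h ↦
    hns ((W.hasSplitMultiplicativeReductionAtPrime_iff_hasSplitMultiplicativeReductionAt v).mpr h)
  refine ⟨?_, hf.primesEquiv_dvd_level_of_not_hasGoodReductionAt hm.not_hasGoodReductionAt⟩
  rw [hf.2, W.LFunction_apply_primesEquiv_of_hasNonsplitMultiplicativeReductionAt hm hnsv]
  push_cast
  ring

end Newform

end Literature.NumberTheory.EllipticCurves.ModularForms

namespace Literature.NumberTheory.EllipticCurves

section Measure

variable {N : ℕ} [NeZero N] {f : CuspForm (Gamma0 N) 2} {p : ℕ} [Fact p.Prime]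

/-- **The distribution relation at the allowable root `α = a_p = −1`, `ε(p) = 0`** (MTT 1986 §I.10
(10.2), case `p ∣ N`): for a newform `f ∈ S₂(Γ₀(N))`, `p ∣ N`, `a_p(f) = −1`, and rational plus symbols,
`∑_{b ≡ a mod pⁿ} [b/pⁿ⁺¹]⁺ = −[a/pⁿ]⁺`. Twin of `sum_fiber_ratPlusSymbol_eq` (`a_p = 1`), from the
general `U_p`-relation `intCast_mul_ratPlusSymbol_of_dvd`. [cite: MazurTateTeitelbaum1986Invent, §I.10 Prop. (10.2)] -/
theorem sum_fiber_ratPlusSymbol_eq_neg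
    (hrat : ∀ r : ℚ, (ratPlusSymbol f r : ℝ) = normalizedPlusSymbol f r)
    (hf : IsNewform0 f) (hpN : p ∣ N) (hap : cuspCoeff f p = -1) (n : ℕ) (a : ZMod (p ^ n)) :
    ∑ b ∈ Finset.univ.filter (fun b : ZMod (p ^ (n + 1)) ↦
        ZMod.castHom (pow_dvd_pow p n.le_succ) (ZMod (p ^ n)) b = a),
      (ratPlusSymbol f ((b.val : ℚ) / (p : ℚ) ^ (n + 1)) : ℚ_[p]) =
      -(ratPlusSymbol f ((a.val : ℚ) / (p : ℚ) ^ n) : ℚ_[p]) := by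
  classical
  haveI : NeZero p := ⟨(Fact.out : p.Prime).ne_zero⟩
  have hp : p.Prime := Fact.out
  have hp0 : (p : ℚ) ≠ 0 := by exact_mod_cast hp.ne_zero
  have hinj : Function.Injective
      (fun j : Fin p ↦ ((a.val + p ^ n * (j : ℕ) : ℕ) : ZMod (p ^ (n + 1)))) := by
    intro j j' h
    have hv := congr_arg ZMod.val h
    simp only [val_classLift] at hv
    exact Fin.ext (Nat.eq_of_mul_eq_mul_left (pow_pos hp.pos n) (by omega))
  rw [filter_castHom_eq_image, Finset.sum_image fun j _ j' _ h ↦ hinj h]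
  set x : ℚ := (a.val : ℚ) / (p : ℚ) ^ n with hx
  have hA : ∀ j : Fin p, ((a.val + p ^ n * (j : ℕ) : ℕ) : ℚ) / (p : ℚ) ^ (n + 1) = (x + j) / p := by
    intro j
    rw [hx]
    push_cast
    field_simp
    ring
  have hHecke := intCast_mul_ratPlusSymbol_of_dvd p hf hp hpN (ap := -1)
    (by rw [hap, Int.cast_neg, Int.cast_one]) hrat x
  rw [Int.cast_neg, Int.cast_one, neg_one_mul] at hHecke
  have hsum : (∑ j : Fin p, ratPlusSymbol f ((x + j) / p)) = -ratPlusSymbol f x := hHecke.symm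
  have hgoal : ∑ j : Fin p, (ratPlusSymbol f (((a.val + p ^ n * (j : ℕ) : ℕ) : ℚ) / (p : ℚ) ^ (n + 1))
      : ℚ_[p]) = ((∑ j : Fin p, ratPlusSymbol f ((x + j) / p) : ℚ) : ℚ_[p]) := by
    rw [Rat.cast_sum]
    refine Finset.sum_congr rfl fun j _ ↦ ?_
    rw [hA]
  simp only [val_classLift]
  rw [hgoal, hsum, Rat.cast_neg]

/-- **The total mass of the signed measure `μₙ = (−1)ⁿ[·/pⁿ]⁺` is `2[0]⁺`** (no exceptional zero at a
non-split prime; Greenberg LNM 1716 §4: "one can take `l_v = 2`"): `∑_{u ∈ (ℤ/p^{e₀})ˣ} (−1)^{e₀}[u/p^{e₀}]⁺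
= ∑_{a ≢ 0 mod p} (−1)[a/p]⁺ = −(a_p[0]⁺ − [0]⁺) = 2[0]⁺`. [cite: GreenbergLNM1716, §4 (PDF p. 113)] -/
theorem sum_units_signed_ratPlusSymbol_eq
    (hrat : ∀ r : ℚ, (ratPlusSymbol f r : ℝ) = normalizedPlusSymbol f r)
    (hf : IsNewform0 f) (hpN : p ∣ N) (hap : cuspCoeff f p = -1) :
    ∑ u : (ZMod (p ^ cyclotomicExponent p))ˣ,
      (-1 : ℚ_[p]) ^ cyclotomicExponent p * (ratPlusSymbol f (((u : ZMod (p ^ cyclotomicExponent p)).val : ℚ) /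
        (p : ℚ) ^ cyclotomicExponent p) : ℚ_[p]) = 2 * (ratPlusSymbol f 0 : ℚ_[p]) := by
  classical
  haveI : NeZero (p ^ 1) := ⟨pow_ne_zero _ (Fact.out : p.Prime).ne_zero⟩
  have hfib := sum_fiber_ratPlusSymbol_eq_neg hrat hf hpN hap
  have hdist : ∀ (n : ℕ) (a : ZMod (p ^ n)),
      ∑ b ∈ Finset.univ.filter (fun b : ZMod (p ^ (n + 1)) ↦
        ZMod.castHom (pow_dvd_pow p n.le_succ) (ZMod (p ^ n)) b = a),
        (-1 : ℚ_[p]) ^ (n + 1) * (ratPlusSymbol f ((b.val : ℚ) / (p : ℚ) ^ (n + 1)) : ℚ_[p]) =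
        (-1 : ℚ_[p]) ^ n * (ratPlusSymbol f ((a.val : ℚ) / (p : ℚ) ^ n) : ℚ_[p]) := by
    intro n a
    rw [← Finset.mul_sum, hfib n a]
    ring
  -- down to level `p`
  have h1 := sum_units_mul_of_distribution
    (μ := fun n a ↦ (-1 : ℚ_[p]) ^ n * (ratPlusSymbol f ((a.val : ℚ) / (p : ℚ) ^ n) : ℚ_[p])) hdist
    (RingHom.id ℚ_[p]) (m := 1) (L := cyclotomicExponent p) le_rfl
    (Nat.pos_of_ne_zero (cyclotomicExponent_ne_zero p)) (fun _ ↦ (1 : ℚ_[p]))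
  simp only [RingHom.id_apply, mul_one] at h1
  rw [h1, sum_units_eq_sum_filter_isUnit (F := fun a : ZMod (p ^ 1) ↦
    (-1 : ℚ_[p]) ^ 1 * (ratPlusSymbol f ((a.val : ℚ) / (p : ℚ) ^ 1) : ℚ_[p]))]
  have hfil : Finset.univ.filter (fun a : ZMod (p ^ 1) ↦ IsUnit a) = Finset.univ.erase 0 := by
    ext a
    simp [isUnit_iff_ne_zero_level_one]
  rw [hfil, Finset.sum_erase_eq_sub (Finset.mem_univ _)]
  -- `∑_{a mod p} [a/p]⁺ = -[0]⁺`
  have h0 := hfib 0 (0 : ZMod (p ^ 0))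
  haveI : Subsingleton (ZMod (p ^ 0)) := (ZMod.subsingleton_iff).mpr (pow_zero p)
  have hfil0 : Finset.univ.filter (fun b : ZMod (p ^ (0 + 1)) ↦
      ZMod.castHom (pow_dvd_pow p (Nat.le_succ 0)) (ZMod (p ^ 0)) b = 0) = Finset.univ :=
    Finset.filter_true_of_mem fun b _ ↦ Subsingleton.elim _ _
  rw [hfil0] at h0
  rw [show (Finset.univ : Finset (ZMod (p ^ 1))) = (Finset.univ : Finset (ZMod (p ^ (0 + 1)))) from
    rfl, ← Finset.mul_sum]
  erw [h0]
  simp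
  ring

end Measure

section Main

variable {W : WeierstrassCurve ℚ} {p : ℕ} [Fact p.Prime] {N : ℕ} [NeZero N]
  {f : CuspForm (Gamma0 N) 2}

/-- **Existence of `L_p(E, T)` at a NON-split multiplicative prime** (Mazur–Tate–Teitelbaum 1986, §I.10
Prop. with `α = a_p = −1`, `ε(p) = 0`; §I.11 bounded; §I.14 (14.3) interpolation; constant term
`(1 − α⁻¹)[0]⁺ = 2[0]⁺`): the Mellin transform of the signed measure `μₙ(a) = (−1)ⁿ[a/pⁿ]⁺` satisfies
`IsMultPAdicLFunctionOf f p (-1)`. [cite: MazurTateTeitelbaum1986Invent, §I.10 Prop. and §I.14 (14.3)] -/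
theorem exists_isMultPAdicLFunctionOf_neg_one_of_nonsplit (hf : IsNewformOf W f)
    (hmult : W.HasMultiplicativeReductionAtPrime p)
    (hns : ¬ W.HasSplitMultiplicativeReductionAtPrime p) :
    ∃ L : PowerSeries ℚ_[p], IsMultPAdicLFunctionOf f p (-1) L := by
  have hQ : coeffField f = ⊥ := hf.coeffField_eq_bot
  have hrat : ∀ r : ℚ, (ratPlusSymbol f r : ℝ) = normalizedPlusSymbol f r :=
    ratCast_ratPlusSymbol_holds hf.1 hQ
  obtain ⟨hap, hpN⟩ := hf.cuspCoeff_eq_neg_one_and_dvd_of_nonsplit hmult hns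
  have hfib := sum_fiber_ratPlusSymbol_eq_neg hrat hf.1 hpN hap
  have hdist : ∀ (n : ℕ) (a : ZMod (p ^ n)),
      ∑ b ∈ Finset.univ.filter (fun b : ZMod (p ^ (n + 1)) ↦
        ZMod.castHom (pow_dvd_pow p n.le_succ) (ZMod (p ^ n)) b = a),
        (-1 : ℚ_[p]) ^ (n + 1) * (ratPlusSymbol f ((b.val : ℚ) / (p : ℚ) ^ (n + 1)) : ℚ_[p]) =
        (-1 : ℚ_[p]) ^ n * (ratPlusSymbol f ((a.val : ℚ) / (p : ℚ) ^ n) : ℚ_[p]) := by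
    intro n a
    rw [← Finset.mul_sum, hfib n a]
    ring
  obtain ⟨C, hC⟩ := exists_norm_ratPlusSymbol_le (p := p) hf.1 hQ
  have hC' : ∀ (n : ℕ) (a : ZMod (p ^ n)),
      ‖(-1 : ℚ_[p]) ^ n * (ratPlusSymbol f ((a.val : ℚ) / (p : ℚ) ^ n) : ℚ_[p])‖ ≤ C := by
    intro n a
    rw [norm_mul, norm_pow, norm_neg, norm_one, one_pow, one_mul]
    exact hC n a
  obtain ⟨L, hbd, h0, hχ⟩ := exists_powerSeries_of_bounded_distribution
    (μ := fun n a ↦ (-1 : ℚ_[p]) ^ n * (ratPlusSymbol f ((a.val : ℚ) / (p : ℚ) ^ n) : ℚ_[p])) hdist hC'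
  refine ⟨L, memIwasawaRat_of_forall_norm_coeff_le hbd, ?_, fun m hm χ _ heven hord ↦ ?_⟩
  · rw [h0, sum_units_signed_ratPlusSymbol_eq hrat hf.1 hpN hap]
    norm_num
  · obtain ⟨m, rfl⟩ := Nat.exists_eq_succ_of_ne_zero hm.ne'
    have h := hχ m χ heven hord
    have hrhs : (∑ a : ZMod (p ^ (m + 1)), χ a * algebraMap ℚ_[p] ℂ_[p]
        ((-1 : ℚ_[p]) ^ (m + 1) * (ratPlusSymbol f ((a.val : ℚ) / (p : ℚ) ^ (m + 1)) : ℚ_[p]))) =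
        algebraMap ℚ_[p] ℂ_[p] ((-1 : ℚ_[p])⁻¹ ^ (m + 1)) * ratTwistedSymbolSum f χ := by
      rw [← sum_mul_algebraMap_ratPlusSymbol_eq, Finset.mul_sum, inv_neg, inv_one]
      refine Finset.sum_congr rfl fun a _ ↦ ?_
      rw [map_mul]
      ring
    rw [hrhs] at h
    exact h

/-- **Discharge of the named fact** `X11RankOneCertificates.exists_isMultPAdicLFunctionOf_neg_one`
(cell `b2b-bsdres`, `Rank1Residual/X11RankOneCertificates/Claim.lean`): the non-split twin of
`exists_isSplitMultPAdicLFunctionOf`. [cite: MazurTateTeitelbaum1986Invent, §I.10 Prop. and §I.14 (14.3)] -/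
theorem Rank1Residual.X11RankOneCertificates.exists_isMultPAdicLFunctionOf_neg_one_holds :
    Rank1Residual.X11RankOneCertificates.exists_isMultPAdicLFunctionOf_neg_one := by
  intro W _ p _ N _ f hmult hns hf
  exact Literature.NumberTheory.EllipticCurves.exists_isMultPAdicLFunctionOf_neg_one_of_nonsplit hf hmult hns

end Main

end Literature.NumberTheory.EllipticCurves

end
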